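import Literature.Probability.LatticeModels.HexMeshCoord
import Literature.Probability.LatticeModels.HexMeshHexagon
import Literature.Probability.LatticeModels.TriMeshTriExtent
import HarnessLib

/-!
# Stray components of the honeycomb mesh graph have small horizontal extent

Support file for item `stmt-CriticalPhenomena-9864` (`HexEndpointApproxExists`, route
`SAWMassiveIsingTilt`): the honeycomb analogue of
`JordanDomain.mul_sub_lt_of_triStray` (`TriMeshTriExtent.lean`).

Setting (`HexMeshCoord.lean`, `HexMeshHexagon.lean`): the honeycomb mesh graph of a domain is the
subgraph `G_N = (triMeshGraph Ω δ).induce N` of the mesh graph of the *fine* triangular lattice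
induced on the non-centre mesh vertices `N = {x ∈ triMeshVertices Ω δ | 3 ∤ x₀ - x₁}`.

**Theorem** (`JordanDomain.mul_sub_lt_of_hexStray`). For a Jordan domain `D` and `D₀ > 0` there
are `ε > 0`, `δ₀ > 0` such that for `0 < δ < δ₀`: if `x, y ∈ N` are joined in `G_N` and every
vertex of `N` joined to `x` in `G_N` has its (square) mesh point within `ε` of `Ω'ᶜ`
(`Ω' = triLinear ⁻¹' D.carrier`), then `δ (y₀ - x₀) < D₀`.

Proof. A `G_N`-walk is a `𝕋`-walk along mesh edges, so the parity theorem
`TriMesh.even_windowCrossCount` of the triangular series applies verbatim to it; the only place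
where the triangular proof used strayness of vertices *not on the walk* is the shallowness of the
corners of the perfect triangles of a window crossed by the walk. Every triangle of the fine
lattice has exactly one centre corner; the two non-centre corners of a perfect triangle are joined
by a honeycomb mesh edge, and consecutive triangles of a column share an edge, so the non-centre
corners of a window are joined *in `G_N`* to the crossing edge used by the walk
(`GN_reachable_corner_of_window`), hence are shallow; a centre corner is within `3δ/2` of a
non-centre corner of the same triangle. The rest (`even_kTriRungCount_of_hexGood`,
`mul_sub_lt_of_hexStray`) is the triangular argument with the constants `ε = r/4`, `δ ≤ r/8`.

Folklore. Anchors: `TriMesh.even_windowCrossCount`, `TriMesh.exists_goodColumn`, `exists_window`,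
`countP_isKCross_eq_sum`, `Mesh.odd_kTriRungCount`, `HexMesh.not_three_dvd_of_triGraph_adj`.
-/

noncomputable section

open Set Metric MeasureTheory
open Literature.Probability.LatticeModels Literature.Probability.LatticeModels.TriMesh
open Literature.Probability.LatticeModels.HexMesh Literature.Probability.RandomPlanarGeometry

namespace Summit.CriticalPhenomena.SAWScalingLimit.Theorems.HexEndpointApprox

variable {Ω : Set ℂ} {δ : ℝ} {N : Set (Site 2)}

/-! ### From `G_N`-walks to `𝕋`-walks -/

/-- A walk in `G_N` is a `𝕋`-walk through vertices of `N` joined to its origin in `G_N`, along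
mesh edges. [folklore] -/
theorem exists_triWalk_of_GN {x y : N} (P : ((triMeshGraph Ω δ).induce N).Walk x y) :
    ∃ W : triGraph.Walk (x : Site 2) (y : Site 2),
      (∀ a ∈ W.support, ∃ ha : a ∈ N,
        ((triMeshGraph Ω δ).induce N).Reachable x ⟨a, ha⟩) ∧
      ∀ d ∈ W.darts, (triMeshGraph Ω δ).Adj d.fst d.snd := by
  induction P with
  | nil =>
    refine ⟨SimpleGraph.Walk.nil, fun a ha => ?_, fun d hd => by simp at hd⟩
    rw [SimpleGraph.Walk.support_nil, List.mem_singleton] at ha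
    exact ha ▸ ⟨_, SimpleGraph.Reachable.refl _⟩
  | @cons a b c h P ih =>
    obtain ⟨W, hWs, hWd⟩ := ih
    have hab : (triMeshGraph Ω δ).Adj (a : Site 2) (b : Site 2) := h
    refine ⟨SimpleGraph.Walk.cons (triMeshGraph_le_triGraph Ω δ hab) W, fun v hv => ?_, fun d hd => ?_⟩
    · rw [SimpleGraph.Walk.support_cons, List.mem_cons] at hv
      rcases hv with rfl | hv
      · exact ⟨a.2, SimpleGraph.Reachable.refl _⟩
      · obtain ⟨hv', hr⟩ := hWs v hv
        exact ⟨hv', h.reachable.trans hr⟩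
    · rw [SimpleGraph.Walk.darts_cons, List.mem_cons] at hd
      rcases hd with rfl | hd
      · exact hab
      · exact hWd d hd

/-! ### Non-centre corners of perfect triangles: the honeycomb ladder -/

/-- Every corner of a triangle has a `𝕋`-adjacent corner of the same triangle (the other end of
its crossing edge). [folklore] -/
theorem exists_isCorner_adj {k n : ℤ} {c : Site 2} (hc : IsCorner k n c) :
    ∃ c', IsCorner k n c' ∧ triGraph.Adj c c' := by
  rcases hc with rfl | rfl | rfl | rfl
  exacts [⟨xR k n, isCorner_xR k n, triGraph_adj_xL_xR k n⟩,
    ⟨xL k n, isCorner_xL k n, (triGraph_adj_xL_xR k n).symm⟩,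
    ⟨xR k (n + 1), isCorner_xR_succ k n, triGraph_adj_xL_xR k (n + 1)⟩,
    ⟨xL k (n + 1), isCorner_xL_succ k n, (triGraph_adj_xL_xR k (n + 1)).symm⟩]

section N

/-- Non-centre mesh vertices are vertices of `G_N`. [folklore] -/
theorem mem_N (hN : N = {x : Site 2 | x ∈ triMeshVertices Ω δ ∧ ¬ (3 : ℤ) ∣ x 0 - x 1})
    {x : Site 2} (hx : x ∈ triMeshVertices Ω δ) (h3 : ¬ (3 : ℤ) ∣ x 0 - x 1) : x ∈ N := by
  rw [hN]; exact ⟨hx, h3⟩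

/-- Vertices of `G_N` are non-centre sites. [folklore] -/
theorem not_dvd_of_mem_N (hN : N = {x : Site 2 | x ∈ triMeshVertices Ω δ ∧ ¬ (3 : ℤ) ∣ x 0 - x 1})
    {x : Site 2} (hx : x ∈ N) : ¬ (3 : ℤ) ∣ x 0 - x 1 := by
  rw [hN] at hx; exact hx.2

/-- Vertices of `G_N` are mesh vertices. [folklore] -/
theorem mem_triMeshVertices_of_mem_N
    (hN : N = {x : Site 2 | x ∈ triMeshVertices Ω δ ∧ ¬ (3 : ℤ) ∣ x 0 - x 1})
    {x : Site 2} (hx : x ∈ N) : x ∈ triMeshVertices Ω δ := by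
  rw [hN] at hx; exact hx.1

variable (hN : N = {x : Site 2 | x ∈ triMeshVertices Ω δ ∧ ¬ (3 : ℤ) ∣ x 0 - x 1})
include hN

/-- **In a perfect triangle the two non-centre corners are joined in `G_N`** (equal, or joined by
the side between them, a mesh edge between non-centre mesh vertices). [folklore] -/
theorem GN_reachable_of_isPerfect (hδ : 0 < δ) {k n : ℤ} (h : IsPerfect Ω δ k n) {v w : Site 2}
    (hv : IsCorner k n v) (hw : IsCorner k n w) (hv3 : ¬ (3 : ℤ) ∣ v 0 - v 1)
    (hw3 : ¬ (3 : ℤ) ∣ w 0 - w 1) :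
    ∃ (hvN : v ∈ N) (hwN : w ∈ N), ((triMeshGraph Ω δ).induce N).Reachable ⟨v, hvN⟩ ⟨w, hwN⟩ := by
  refine ⟨mem_N hN (h.2 v hv) hv3, mem_N hN (h.2 w hw) hw3, ?_⟩
  by_cases hne : v = w
  · subst hne; rfl
  · have hadj : (triMeshGraph Ω δ).Adj v w := h.1.triMeshGraph_adj hδ hv hw hne
    exact SimpleGraph.Adj.reachable (G := (triMeshGraph Ω δ).induce N) hadj

/-- **Honeycomb ladder.** In a run of consecutive perfect triangles `n₁, …, n₁ + m` of column
`k`, every non-centre corner of every triangle of the run is joined in `G_N` to any non-centre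
corner of the first triangle: consecutive triangles share a crossing edge, whose two ends are
`𝕋`-adjacent, so one of them is a non-centre corner of both. [folklore] -/
theorem GN_reachable_of_perfect_run (hδ : 0 < δ) {k n₁ : ℤ} {m : ℕ}
    (h : ∀ i : ℕ, i ≤ m → IsPerfect Ω δ k (n₁ + i)) {w : Site 2} (hw : IsCorner k n₁ w)
    (hw3 : ¬ (3 : ℤ) ∣ w 0 - w 1) {i : ℕ} (hi : i ≤ m) {v : Site 2}
    (hv : IsCorner k (n₁ + i) v) (hv3 : ¬ (3 : ℤ) ∣ v 0 - v 1) :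
    ∃ (hwN : w ∈ N) (hvN : v ∈ N), ((triMeshGraph Ω δ).induce N).Reachable ⟨w, hwN⟩ ⟨v, hvN⟩ := by
  induction i generalizing v with
  | zero =>
    have h0 : IsPerfect Ω δ k n₁ := by simpa using h 0 (Nat.zero_le _)
    have hv' : IsCorner k n₁ v := by simpa using hv
    exact GN_reachable_of_isPerfect hN hδ h0 hw hv' hw3 hv3
  | succ i ih =>
    have hi' : i ≤ m := (Nat.le_succ i).trans hi
    have heq : n₁ + ((i + 1 : ℕ) : ℤ) = n₁ + (i : ℕ) + 1 := by push_cast; ring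
    -- the shared crossing edge `n₁ + i + 1` has a non-centre end `u`
    obtain ⟨u, hu_i, hu_succ, hu3⟩ : ∃ u : Site 2, IsCorner k (n₁ + (i : ℕ)) u ∧
        IsCorner k (n₁ + ((i + 1 : ℕ) : ℤ)) u ∧ ¬ (3 : ℤ) ∣ u 0 - u 1 := by
      by_cases h3 : (3 : ℤ) ∣ (xL k (n₁ + (i : ℕ) + 1)) 0 - (xL k (n₁ + (i : ℕ) + 1)) 1
      · refine ⟨xR k (n₁ + (i : ℕ) + 1), isCorner_xR_succ k _, ?_,
          not_three_dvd_of_triGraph_adj (triGraph_adj_xL_xR k _) h3⟩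
        rw [heq]; exact isCorner_xR k _
      · refine ⟨xL k (n₁ + (i : ℕ) + 1), isCorner_xL_succ k _, ?_, h3⟩
        rw [heq]; exact isCorner_xL k _
    obtain ⟨hwN, huN, h1⟩ := ih hi' hu_i hu3
    obtain ⟨huN', hvN, h2⟩ := GN_reachable_of_isPerfect hN hδ (h (i + 1) hi) hu_succ hv hu3 hv3
    exact ⟨hwN, hvN, h1.trans h2⟩

/-- **Non-centre corners of a window are joined in `G_N` to any traversed crossing edge.** In a
window `(b, t)` of column `k` (triangles strictly between `b` and `t` perfect) with at least one
perfect triangle, every non-centre corner of every perfect triangle of the window is joined in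
`G_N` to the left end of any crossing edge `n'` of the window (`b < n' ≤ t`), provided that end is
a non-centre site. [folklore] -/
theorem GN_reachable_corner_of_window (hδ : 0 < δ) {k b t : ℤ}
    (hwin : ∀ i, b < i → i < t → IsPerfect Ω δ k i) {n' : ℤ} (h1 : b < n') (h2 : n' ≤ t)
    (hbt : b + 1 < t) (hl3 : ¬ (3 : ℤ) ∣ (xL k n') 0 - (xL k n') 1) {i : ℤ} (hi1 : b < i)
    (hi2 : i < t) {c : Site 2} (hc : IsCorner k i c) (hc3 : ¬ (3 : ℤ) ∣ c 0 - c 1) :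
    ∃ (hl : xL k n' ∈ N) (hmem : c ∈ N),
      ((triMeshGraph Ω δ).induce N).Reachable ⟨xL k n', hl⟩ ⟨c, hmem⟩ := by
  -- the run `b + 1, …, t - 1`
  set m : ℕ := (t - b - 2).toNat with hm
  have hm' : (m : ℤ) = t - b - 2 := Int.toNat_of_nonneg (by omega)
  have hrun : ∀ m' : ℕ, m' ≤ m → IsPerfect Ω δ k (b + 1 + m') := fun m' hm'' =>
    hwin _ (by omega) (by omega)
  -- a non-centre corner `w` of the first triangle `b + 1`
  obtain ⟨w, hw, hw3⟩ : ∃ w : Site 2, IsCorner k (b + 1) w ∧ ¬ (3 : ℤ) ∣ w 0 - w 1 := by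
    by_cases h3 : (3 : ℤ) ∣ (xL k (b + 1)) 0 - (xL k (b + 1)) 1
    · exact ⟨xR k (b + 1), isCorner_xR k _,
        not_three_dvd_of_triGraph_adj (triGraph_adj_xL_xR k _) h3⟩
    · exact ⟨xL k (b + 1), isCorner_xL k _, h3⟩
  -- the target corner
  set mi : ℕ := (i - b - 1).toNat with hmi
  have hmi' : (mi : ℤ) = i - b - 1 := Int.toNat_of_nonneg (by omega)
  have hmin : mi ≤ m := by omega
  have hieq : i = b + 1 + mi := by omega
  have hc' : IsCorner k (b + 1 + mi) c := hieq ▸ hc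
  obtain ⟨hwN, hcN, htarget⟩ := GN_reachable_of_perfect_run hN hδ hrun hw hw3 hmin hc' hc3
  -- the left end of the crossing edge `n'`
  obtain ⟨hwN', hlN, hsrc⟩ : ∃ (hwN : w ∈ N) (hlN : xL k n' ∈ N),
      ((triMeshGraph Ω δ).induce N).Reachable ⟨w, hwN⟩ ⟨xL k n', hlN⟩ := by
    by_cases hlast : n' = t
    · -- `xL k t` is a corner of the top triangle `t - 1 = b + 1 + m` of the run
      have heq : xL k n' = xL k (b + 1 + m + 1) := by congr 1; omega
      have hcor : IsCorner k (b + 1 + m) (xL k n') := by rw [heq]; exact isCorner_xL_succ k _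
      exact GN_reachable_of_perfect_run hN hδ hrun hw hw3 le_rfl hcor hl3
    · set m' : ℕ := (n' - b - 1).toNat with hm''
      have hm''' : (m' : ℤ) = n' - b - 1 := Int.toNat_of_nonneg (by omega)
      have hm'n : m' ≤ m := by omega
      have heq : xL k n' = xL k (b + 1 + m') := by congr 1; omega
      have hcor : IsCorner k (b + 1 + m') (xL k n') := by rw [heq]; exact isCorner_xL k _
      exact GN_reachable_of_perfect_run hN hδ hrun hw hw3 hm'n hcor hl3
  exact ⟨hlN, hcN, hsrc.symm.trans htarget⟩

end N

/-! ### One window of a good column is crossed an even number of times -/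

open Classical in
/-- **Evenness, window by window (honeycomb).** As `TriMesh.even_windowCrossCount_of_good`, for a
`𝕋`-walk `W` along mesh edges whose vertices lie in `N` and are joined *in `G_N`* to a vertex
`x` whose whole `G_N`-component is within `ε'` of `Ω'ᶜ`, `ε' + 2δ ≤ ε`: either no crossing edge
of the window is traversed, or the window is short — its non-centre corners are joined in `G_N`
to the walk (`GN_reachable_corner_of_window`), its centre corners are within `3δ/2` of those, so
all corners are within `ε` of `Ω'ᶜ` and the column is good — and `TriMesh.even_windowCrossCount`
applies. [folklore] -/
theorem even_windowCrossCount_of_hexGood (D : JordanDomain)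
    (hN : N = {x : Site 2 | x ∈ triMeshVertices D.carrier δ ∧ ¬ (3 : ℤ) ∣ x 0 - x 1})
    {D₀ η ε ε' : ℝ} (hδ : 0 < δ) (hηD : η ≤ D₀ / 16) (hε' : ε' + 2 * δ ≤ ε)
    (hulc : ∀ p ∈ (closure (triLinear ⁻¹' D.carrier))ᶜ, ∀ q ∈ (closure (triLinear ⁻¹' D.carrier))ᶜ,
      dist p q < η → JoinedIn ((closure (triLinear ⁻¹' D.carrier))ᶜ ∩ ball p (D₀ / 16)) p q)
    {k b t : ℤ} (hbt : b < t) (hnb : ¬ IsPerfect D.carrier δ k b) (hnt : ¬ IsPerfect D.carrier δ k t)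
    (hwin : ∀ i, b < i → i < t → IsPerfect D.carrier δ k i) {M : ℕ} (hM8 : δ * M + 8 * δ < η)
    (hgood : ¬ ∀ m : ℕ, m < M → IsPerfect D.carrier δ k (b + 1 + m) ∧
      ∀ c, IsCorner k (b + 1 + m) c → infDist (meshPoint δ c) (triLinear ⁻¹' D.carrier)ᶜ < ε)
    {x : N}
    (hstray : ∀ z : N, ((triMeshGraph D.carrier δ).induce N).Reachable x z →
      infDist (meshPoint δ (z : Site 2)) (triLinear ⁻¹' D.carrier)ᶜ < ε')
    {u v : Site 2} (W : triGraph.Walk u v)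
    (hWs : ∀ a ∈ W.support, ∃ ha : a ∈ N, ((triMeshGraph D.carrier δ).induce N).Reachable x ⟨a, ha⟩)
    (hWd : ∀ d ∈ W.darts, (triMeshGraph D.carrier δ).Adj d.fst d.snd)
    (hu : D₀ / 8 ≤ dist (meshPoint δ u) (kcenter δ k b))
    (hv : D₀ / 8 ≤ dist (meshPoint δ v) (kcenter δ k b)) :
    Even (W.edges.countP fun e => decide (∃ n, b < n ∧ n ≤ t ∧ e = kcross k n)) := by
  by_cases hzero : (W.edges.countP fun e => decide (∃ n, b < n ∧ n ≤ t ∧ e = kcross k n)) = 0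
  · rw [hzero]; exact ⟨0, rfl⟩
  obtain ⟨e, he, hpe⟩ := List.countP_pos_iff.1 (Nat.pos_of_ne_zero hzero)
  simp only [decide_eq_true_eq] at hpe
  obtain ⟨n', hn'1, hn'2, hen⟩ := hpe
  have he' : s(xL k n', xR k n') ∈ W.edges := by
    rw [hen, kcross] at he; exact he
  obtain ⟨hl, hreachl⟩ := hWs (xL k n') (W.fst_mem_support_of_mem_edges he')
  have hl3 : ¬ (3 : ℤ) ∣ (xL k n') 0 - (xL k n') 1 := not_dvd_of_mem_N hN hl
  -- the window is short
  have hshortZ : t - b ≤ M := by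
    by_contra hlong
    push Not at hlong
    apply hgood
    intro m hm
    have hmZ : (m : ℤ) < M := by exact_mod_cast hm
    have hperf : IsPerfect D.carrier δ k (b + 1 + m) := hwin _ (by omega) (by omega)
    have hnc : ∀ c, IsCorner k (b + 1 + m) c → ¬ (3 : ℤ) ∣ c 0 - c 1 →
        infDist (meshPoint δ c) (triLinear ⁻¹' D.carrier)ᶜ < ε' := by
      intro c hc hc3
      obtain ⟨hl', hmem, hr⟩ := GN_reachable_corner_of_window hN hδ hwin hn'1 hn'2 (by omega) hl3
        (i := b + 1 + m) (by omega) (by omega) hc hc3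
      exact hstray ⟨c, hmem⟩ (hreachl.trans hr)
    refine ⟨hperf, fun c hc => ?_⟩
    by_cases hc3 : (3 : ℤ) ∣ c 0 - c 1
    · -- a centre corner is within `3δ/2` of a non-centre corner of the same triangle
      obtain ⟨c', hc', hcc'⟩ := exists_isCorner_adj hc
      have hc'3 : ¬ (3 : ℤ) ∣ c' 0 - c' 1 := not_three_dvd_of_triGraph_adj hcc' hc3
      have h2 := infDist_le_infDist_add_dist (s := (triLinear ⁻¹' D.carrier)ᶜ)
        (x := meshPoint δ c) (y := meshPoint δ c')
      linarith [hnc c' hc' hc'3, dist_meshPoint_lt_of_triGraph_adj hδ hcc']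
    · linarith [hnc c hc hc3]
  have hshort : δ * (t - b) / 2 + 8 * δ < η := by
    have : δ * ((t : ℝ) - b) ≤ δ * M :=
      mul_le_mul_of_nonneg_left (by exact_mod_cast hshortZ) hδ.le
    have hnn : 0 ≤ δ * ((t : ℝ) - b) := mul_nonneg hδ.le (by
      have : (b : ℝ) < t := by exact_mod_cast hbt
      linarith)
    linarith
  exact even_windowCrossCount D hδ hηD hulc hbt hnb hnt hshort W
    (fun a ha => mem_triMeshVertices_of_mem_N hN (hWs a ha).1) hWd hu hv

/-! ### A good column is crossed an even number of times -/

open Classical in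
/-- **All windows at once (honeycomb).** As `TriMesh.even_kTriRungCount_of_good`: if column `k`
is good at every index and both ends of `W` are at horizontal distance `≥ 3D₀/8` from the midline
`re z = δ(k + ½)`, then `W` traverses the rungs of column `k` an even number of times. [folklore] -/
theorem even_kTriRungCount_of_hexGood (D : JordanDomain)
    (hN : N = {x : Site 2 | x ∈ triMeshVertices D.carrier δ ∧ ¬ (3 : ℤ) ∣ x 0 - x 1})
    {D₀ η ε ε' : ℝ} (hδ : 0 < δ) (hD₀ : 0 < D₀) (hηD : η ≤ D₀ / 16) (hε' : ε' + 2 * δ ≤ ε)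
    (hulc : ∀ p ∈ (closure (triLinear ⁻¹' D.carrier))ᶜ, ∀ q ∈ (closure (triLinear ⁻¹' D.carrier))ᶜ,
      dist p q < η → JoinedIn ((closure (triLinear ⁻¹' D.carrier))ᶜ ∩ ball p (D₀ / 16)) p q)
    {k : ℤ} {M : ℕ} (hM8 : δ * M + 8 * δ < η)
    (hgood : ∀ j : ℤ, ¬ ∀ m : ℕ, m < M → IsPerfect D.carrier δ k (j + 1 + m) ∧
      ∀ c, IsCorner k (j + 1 + m) c → infDist (meshPoint δ c) (triLinear ⁻¹' D.carrier)ᶜ < ε)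
    {x : N}
    (hstray : ∀ z : N, ((triMeshGraph D.carrier δ).induce N).Reachable x z →
      infDist (meshPoint δ (z : Site 2)) (triLinear ⁻¹' D.carrier)ᶜ < ε')
    {u v : Site 2} (W : triGraph.Walk u v)
    (hWs : ∀ a ∈ W.support, ∃ ha : a ∈ N, ((triMeshGraph D.carrier δ).induce N).Reachable x ⟨a, ha⟩)
    (hWd : ∀ d ∈ W.darts, (triMeshGraph D.carrier δ).Adj d.fst d.snd)
    (hu : 3 * D₀ / 8 ≤ |δ * u 0 - δ * (k + 1 / 2)|) (hv : 3 * D₀ / 8 ≤ |δ * v 0 - δ * (k + 1 / 2)|) :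
    Even (Mesh.kTriRungCount k W) := by
  have hΩb : Bornology.IsBounded (triLinear ⁻¹' D.carrier) := D.triPreimage.isBounded
  -- windows of the column, and the sum decomposition
  choose wb wt hwb hwt hnb hnt hwin using fun j => exists_window (Ω := D.carrier) hΩb hδ k j
  set HB : Finset ℤ := (W.support.map fun a => a 1).toFinset with hHB
  set NB : Finset ℤ := HB.image (fun h => 2 * h) ∪ HB.image (fun h => 2 * h - 1) with hNB
  set B : Finset ℤ := NB.image wb with hB
  have hBkey : ∀ e ∈ W.edges, ∀ n, e = kcross k n → wb n ∈ B := by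
    intro e he n hen
    have he' : s(xL k n, xR k n) ∈ W.edges := by
      rw [hen, kcross] at he; exact he
    refine Finset.mem_image.2 ⟨n, ?_, rfl⟩
    have hmem : cTop n ∈ HB := by
      rw [hHB, List.mem_toFinset, List.mem_map]
      exact ⟨xL k n, W.fst_mem_support_of_mem_edges he', rfl⟩
    rw [hNB, Finset.mem_union, Finset.mem_image, Finset.mem_image]
    have e1 := two_mul_cBot_add n
    rcases emod_two_eq n with h | h
    · left; exact ⟨cTop n, hmem, by rw [cTop_eq]; omega⟩
    · right; exact ⟨cTop n, hmem, by rw [cTop_eq]; omega⟩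
  have hsum := countP_isKCross_eq_sum k wb B W.edges hBkey
  -- every window met is crossed an even number of times
  have heven : ∀ b ∈ B, Even (W.edges.countP fun e => decide (∃ n, e = kcross k n ∧ wb n = b)) := by
    intro b hb
    obtain ⟨j₁, -, rfl⟩ := Finset.mem_image.1 hb
    have hiff : ∀ e, (∃ n, e = kcross k n ∧ wb n = wb j₁) ↔
        ∃ n, wb j₁ < n ∧ n ≤ wt j₁ ∧ e = kcross k n := by
      intro e
      constructor
      · rintro ⟨n, rfl, hn⟩
        have ht : wt n = wt j₁ := by
          by_contra hne'
          rcases lt_or_gt_of_ne hne' with h | h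
          · exact hnt n (hwin j₁ (wt n) (by rw [← hn]; exact (hwb n).trans_le (hwt n)) h)
          · exact hnt j₁ (hwin n (wt j₁) (by rw [hn]; exact (hwb j₁).trans_le (hwt j₁)) h)
        exact ⟨n, hn ▸ hwb n, ht ▸ hwt n, rfl⟩
      · rintro ⟨n, h1, h2, rfl⟩
        exact ⟨n, rfl, (window_eq_of_mem (hnb n) (hnt n) (hwin n) (hnb j₁) (hnt j₁) (hwin j₁)
          (hwb n) (hwt n) h1 h2).1⟩
    have hcongr : (W.edges.countP fun e => decide (∃ n, e = kcross k n ∧ wb n = wb j₁)) =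
        W.edges.countP fun e => decide (∃ n, wb j₁ < n ∧ n ≤ wt j₁ ∧ e = kcross k n) :=
      List.countP_congr fun e _ => by simp only [hiff e]
    rw [hcongr]
    exact even_windowCrossCount_of_hexGood D hN hδ hηD hε' hulc ((hwb j₁).trans_le (hwt j₁))
      (hnb j₁) (hnt j₁) (hwin j₁) hM8 (hgood (wb j₁)) hstray W hWs hWd
      (le_dist_kcenter_of_le_abs (by linarith [hu])) (le_dist_kcenter_of_le_abs (by linarith [hv]))
  have hcongr' : Mesh.kTriRungCount k W = W.edges.countP fun e => decide (IsKCross k e) := by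
    unfold Mesh.kTriRungCount
    exact List.countP_congr fun e _ => by simp only [isKCross_iff_isKTriRung]
  rw [hcongr', hsum]
  exact Finset.even_sum _ fun b hb => heven b hb

/-! ### The theorem -/

/-- **Stray components of the honeycomb mesh graph have horizontal extent `< D₀`.** For a Jordan
domain `D` (in the embedded coordinates of the fine triangular lattice; `Ω' = triLinear ⁻¹'
D.carrier` the sheared domain, square mesh points) and `D₀ > 0` there are `ε > 0` and `δ₀ > 0`
such that for `0 < δ < δ₀`: if `x`, `y` are joined in the honeycomb mesh graph
`G_N = (triMeshGraph D.carrier δ).induce N`, `N` the non-centre mesh vertices, and every vertex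
joined to `x` in `G_N` has its mesh point within `ε` of `Ω'ᶜ`, then `δ (y₀ - x₀) < D₀`.
[folklore] -/
theorem _root_.Literature.Probability.RandomPlanarGeometry.JordanDomain.mul_sub_lt_of_hexStray
    (D : JordanDomain) {D₀ : ℝ} (hD₀ : 0 < D₀) :
    ∃ ε > 0, ∃ δ₀ > 0, ∀ δ : ℝ, 0 < δ → δ < δ₀ → ∀ N : Set (Site 2),
      N = {x : Site 2 | x ∈ triMeshVertices D.carrier δ ∧ ¬ (3 : ℤ) ∣ x 0 - x 1} →
      ∀ (x y : N), ((triMeshGraph D.carrier δ).induce N).Reachable x y →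
        (∀ z : N, ((triMeshGraph D.carrier δ).induce N).Reachable x z →
          infDist (meshPoint δ (z : Site 2)) (triLinear ⁻¹' D.carrier)ᶜ < ε) →
        δ * ((y : Site 2) 0 - (x : Site 2) 0) < D₀ := by
  set D' := D.triPreimage with hD'
  have hΩo : IsOpen (triLinear ⁻¹' D.carrier) := D'.isOpen
  have hΩb : Bornology.IsBounded (triLinear ⁻¹' D.carrier) := D'.isBounded
  have hne : (triLinear ⁻¹' D.carrier)ᶜ.Nonempty := by
    by_contra h
    rw [not_nonempty_iff_eq_empty, compl_empty_iff] at h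
    exact NormedSpace.unbounded_univ ℝ ℂ (h ▸ hΩb)
  -- uniform local connectedness of the exterior of the sheared domain at radius `D₀/16`
  obtain ⟨η₀, hη₀, hulc₀⟩ := D'.exterior_joinedIn_of_dist_lt (show 0 < D₀ / 16 by positivity)
  set η := min η₀ (D₀ / 16) with hηdef
  have hη : 0 < η := lt_min hη₀ (by positivity)
  have hηD : η ≤ D₀ / 16 := min_le_right _ _
  have hulc : ∀ a ∈ (closure (triLinear ⁻¹' D.carrier))ᶜ, ∀ b ∈ (closure (triLinear ⁻¹' D.carrier))ᶜ,
      dist a b < η → JoinedIn ((closure (triLinear ⁻¹' D.carrier))ᶜ ∩ ball a (D₀ / 16)) a b :=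
    fun a ha b hb hab => hulc₀ a ha b hb (hab.trans_le (min_le_left _ _))
  -- the area budget
  have hv : 0 < volume.real (ball (0 : ℂ) 1) :=
    ENNReal.toReal_pos (measure_ball_pos volume (0 : ℂ) one_pos).ne' measure_ball_lt_top.ne
  have hApos : 0 < D₀ * η * volume.real (ball (0 : ℂ) 1) / 32768 := by positivity
  obtain ⟨r, hr, hcollar⟩ := exists_pos_volume_real_innerCollar_lt hΩo hΩb hne hApos
  refine ⟨r / 4, by positivity, min (r / 8) (min (η / 64) (D₀ / 64)), by positivity, ?_⟩
  intro δ hδ hδlt N hN x y hreach hstray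
  have hδr8 : δ ≤ r / 8 := hδlt.le.trans (min_le_left _ _)
  have hδr : δ ≤ r / 4 := by linarith
  have hδη : δ < η / 64 := hδlt.trans_le ((min_le_right _ _).trans (min_le_left _ _))
  have hδD : δ < D₀ / 64 := hδlt.trans_le ((min_le_right _ _).trans (min_le_right _ _))
  have hε' : r / 4 + 2 * δ ≤ r / 2 := by linarith
  by_contra hge
  push Not at hge
  obtain ⟨k, M, hk1, hk2, hxfar, hyfar, hM8, hgood⟩ :=
    exists_goodColumn hΩb hδ hη hD₀ hδη hδD hδr hcollar hge
  -- the walk: odd and even crossing counts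
  obtain ⟨P⟩ := hreach
  obtain ⟨W, hWs, hWd⟩ := exists_triWalk_of_GN P
  have hodd : Odd (Mesh.kTriRungCount k W) := Mesh.odd_kTriRungCount k W hk1 hk2
  have heven : Even (Mesh.kTriRungCount k W) :=
    even_kTriRungCount_of_hexGood D hN hδ hD₀ hηD hε' hulc hM8 hgood hstray W hWs hWd hxfar hyfar
  exact (Nat.not_even_iff_odd.2 hodd) heven

end Summit.CriticalPhenomena.SAWScalingLimit.Theorems.HexEndpointApprox
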